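import Mathlib
import Literature.Analysis.ODE.LadderIsometry
import Literature.Analysis.ODE.LadderKernel
import Literature.Analysis.ODE.LadderApproxTools
import Literature.Analysis.Convolution.MollifyDeriv1D
import HarnessLib

/-!
# The exact ladder isometry at the natural regularity (`Cⁿ` / `Cⁿ⁺¹`) by smooth approximation

Analysis/ODE support file (everything proved, no definitions). The exact (`c = 1`) ladder
isometries of `LadderIsometry.lean` were proved for `f ∈ C^{2n}` (velocity form) and
`f ∈ C^{2n+2}` (position form), the regularity consumed by the boundary-form recursion. Here they are
lowered to the regularity at which both sides make sense — `f ∈ Cⁿ`, resp. `f ∈ Cⁿ⁺¹`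
(`integral_sq_ladder_eq_of_contDiff`, `integral_energy_ladder_eq_of_contDiff`) — for `f` equal to
an odd polynomial of degree `< 2n` on `(−∞, R₁)` and vanishing on `[B, ∞)`: write `f = pχ + r` with a
smooth cutoff `χ` (`= 1` below `R₁`, `= 0` beyond `B+1`) and `r ∈ C^m` supported in `[R₁, B+1]`,
replace `r` by its mollification (`MollifyDeriv1D.lean`: all derivatives of order `≤ m` converge
uniformly, the support grows by `2ε`), apply the smooth isometry with the gap `[0, R₁ − 2ε]`, and
pass to the limit using the expansion `ladder ι n u = Σ β_j ι^{n−j} u⁽ʲ⁾`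
(`InverseSquareLadderExpansion.lean`) to control the ladder by the derivatives. With this the
odd-dimensional exterior-energy identity (`InverseSquareExteriorEnergyIdentity.lean`) holds for
`C² × C¹` Cauchy data, the class of the Regge–Wheeler items of route PhotonSphereChannels
(`WindowedShellChannels`, stmt-FinalStateConjecture-14085). Folklore.
-/

noncomputable section

namespace Literature.Analysis.ODE

open Set Filter Topology Finset Real Polynomial MeasureTheory Literature.Analysis.Convolution
  Literature.Analysis.Calculus

variable {ι : ℝ → ℝ}

/-- **Exact ladder isometry, velocity data, `f ∈ Cⁿ`.** [cite: KenigEtAl2015, §2] -/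
theorem integral_sq_ladder_eq_of_contDiff (hι : ContDiff ℝ (⊤ : ℕ∞) ι)
    (hιeq : ∀ x : ℝ, 1 / 2 ≤ x → ι x = x⁻¹) {n : ℕ} {f : ℝ → ℝ} (hf : ContDiff ℝ n f)
    {p : ℝ[X]} (hp : ∀ i, Even i → p.coeff i = 0) (hpdeg : p.natDegree < 2 * n) {R R₁ B : ℝ}
    (hR : 1 / 2 < R) (hRR₁ : R < R₁) (hR₁B : R₁ ≤ B) (hfp : ∀ x, x < R₁ → f x = p.eval x)
    (hfB : ∀ x, B ≤ x → f x = 0) :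
    ∫ x in R..B, (ladder ι n f x) ^ 2 = ∫ x in (0 : ℝ)..B, (iteratedDeriv n f x) ^ 2 := by
  have hn : 1 ≤ n := by
    rcases Nat.eq_zero_or_pos n with h0 | h0
    · subst h0; simp at hpdeg
    · exact h0
  -- decomposition `f = pχ + r`
  obtain ⟨χ, hχC, hχ1, hχ0⟩ := exists_cutoff_Iic_Ici (by linarith : R₁ < B + 1)
  set P : ℝ → ℝ := fun x => p.eval x * χ x with hPdef
  have hPC : ContDiff ℝ (⊤ : ℕ∞) P := (contDiff_polynomial_eval p _).mul hχC
  set r : ℝ → ℝ := fun x => f x - P x with hrdef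
  have hrC : ContDiff ℝ n r := hf.sub (hPC.of_le (by exact_mod_cast le_top))
  have hr_lo : ∀ y, y < R₁ → r y = 0 := fun y hy => by
    simp only [hrdef, hPdef, hfp y hy, hχ1 y hy.le]; ring
  have hr_hi : ∀ y, B + 1 < y → r y = 0 := fun y hy => by
    simp only [hrdef, hPdef, hfB y (by linarith), hχ0 y hy.le]; ring
  -- the constants
  obtain ⟨Λ, hΛ0, hΛ⟩ := exists_abs_ladder_le hι hιeq n
  have hB2 : R ≤ B + 2 := by linarith
  have hLfC : Continuous (ladder ι n f) :=
    (contDiff_ladder hι (m := 0) (by simpa using hf)).continuous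
  have hDfC : Continuous (iteratedDeriv n f) := hf.continuous_iteratedDeriv n le_rfl
  obtain ⟨ML, hML⟩ := isCompact_Icc.exists_bound_of_continuousOn (f := ladder ι n f) (s := Icc R (B + 2))
    hLfC.continuousOn
  obtain ⟨MD, hMD⟩ := isCompact_Icc.exists_bound_of_continuousOn (f := iteratedDeriv n f)
    (s := Icc 0 (B + 2)) hDfC.continuousOn
  have hML0 : 0 ≤ ML := (norm_nonneg _).trans (hML R ⟨le_rfl, hB2⟩)
  have hMD0 : 0 ≤ MD := (norm_nonneg _).trans (hMD 0 ⟨le_rfl, by linarith⟩)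
  -- the identity on `[R, B+2]` / `[0, B+2]` up to an arbitrarily small error
  have main : ∀ η : ℝ, 0 < η → η ≤ 1 →
      |(∫ x in R..(B + 2), (ladder ι n f x) ^ 2) - ∫ x in (0 : ℝ)..(B + 2), (iteratedDeriv n f x) ^ 2|
        ≤ (B + 2 - R) * (Λ * η * (2 * ML + Λ * η)) + (B + 2) * (η * (2 * MD + η)) := by
    intro η hη hη1
    obtain ⟨ε, hε, hε1, φ, hφC, hφlo, hφhi, hφapp⟩ := exists_smooth_approx_Ck hrC hr_lo hr_hi hη
      (lt_min (by linarith : (0 : ℝ) < (R₁ - R) / 3) one_half_pos)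
    have hεR : ε < (R₁ - R) / 3 := lt_of_lt_of_le hε1 (min_le_left _ _)
    have hεh : ε < 1 / 2 := lt_of_lt_of_le hε1 (min_le_right _ _)
    -- the smooth competitor `fη = pχ + φ`
    set g : ℝ → ℝ := fun x => P x + φ x with hgdef
    have hgC : ContDiff ℝ ((2 * n : ℕ) : ℕ∞) g := (hPC.add hφC).of_le (by exact_mod_cast le_top)
    have hgp : ∀ x ∈ Icc 0 (R₁ - 2 * ε), g x = p.eval x := by
      intro x hx
      simp only [hgdef, hPdef, hχ1 x (by linarith [hx.2]), hφlo x hx.2]; ring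
    have hgB : ∀ x, B + 2 ≤ x → g x = 0 := by
      intro x hx
      simp only [hgdef, hPdef, hχ0 x (by linarith), hφhi x (by linarith)]; ring
    have hiso := integral_sq_ladder_eq hι hιeq hgC hp hpdeg hR (by linarith : R < R₁ - 2 * ε)
      (by linarith : R₁ - 2 * ε ≤ B + 2) hgp hgB
    -- differences of derivatives and ladders
    have hgn : ContDiff ℝ n g := hgC.of_le (by exact_mod_cast (by omega : n ≤ 2 * n))
    have hφn : ContDiff ℝ n φ := hφC.of_le (by exact_mod_cast le_top)
    have hdiff : ∀ x, g x - f x = φ x - r x := fun x => by simp only [hgdef, hrdef]; ring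
    have hgf : (fun x => g x - f x) = fun x => φ x - r x := funext hdiff
    have hDd : ∀ j, j ≤ n → ∀ x, |iteratedDeriv j (fun y => φ y - r y) x| ≤ η := by
      intro j hj x
      rw [iteratedDeriv_fun_sub (hφn.contDiffAt.of_le (by exact_mod_cast hj))
        (hrC.contDiffAt.of_le (by exact_mod_cast hj))]
      exact hφapp j hj x
    have hDtop : ∀ x, |iteratedDeriv n g x - iteratedDeriv n f x| ≤ η := by
      intro x
      have e : iteratedDeriv n g x - iteratedDeriv n f x = iteratedDeriv n (fun y => g y - f y) x := by
        rw [iteratedDeriv_fun_sub hgn.contDiffAt hf.contDiffAt]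
      rw [e, hgf]; exact hDd n le_rfl x
    have hLd : ∀ x ∈ Icc R (B + 2), |ladder ι n g x - ladder ι n f x| ≤ Λ * η := by
      intro x hx
      have e : ladder ι n g x - ladder ι n f x = ladder ι n (fun y => φ y - r y) x := by
        have := congrFun (ladder_sub hι hgn hf) x
        rw [← this, hgf]
      rw [e]
      exact hΛ _ (hφn.sub hrC) η hDd x (lt_of_lt_of_le hR hx.1)
    -- conclude
    have e1 := abs_integral_sq_sub_sq_le
      ((contDiff_ladder hι (m := 0) (by simpa using hgn)).continuous) hLfC hB2 (by positivity) hLd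
      (fun x hx => by have := hML x hx; rwa [Real.norm_eq_abs] at this)
    have e2 := abs_integral_sq_sub_sq_le (hgn.continuous_iteratedDeriv n le_rfl) hDfC
      (by linarith : (0 : ℝ) ≤ B + 2) hη.le (fun x _ => hDtop x)
      (fun x hx => by have := hMD x hx; rwa [Real.norm_eq_abs] at this)
    rw [hiso] at e1
    have htri := abs_sub_le (∫ x in R..(B + 2), (ladder ι n f x) ^ 2)
      (∫ x in (0 : ℝ)..(B + 2), (iteratedDeriv n g x) ^ 2)
      (∫ x in (0 : ℝ)..(B + 2), (iteratedDeriv n f x) ^ 2)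
    rw [abs_sub_comm] at e1
    have : (B + 2 - 0) * (η * (2 * MD + η)) = (B + 2) * (η * (2 * MD + η)) := by ring
    linarith
  -- let `η → 0`
  have hBR : 0 ≤ B + 2 - R := by linarith
  have hB0 : 0 ≤ B + 2 := by linarith
  set Cst : ℝ := (B + 2 - R) * (Λ * (2 * ML + Λ)) + (B + 2) * (1 * (2 * MD + 1)) with hCst
  have hCst0 : 0 ≤ Cst := by
    rw [hCst]
    exact add_nonneg (mul_nonneg hBR (by positivity)) (mul_nonneg hB0 (by positivity))
  have heq : (∫ x in R..(B + 2), (ladder ι n f x) ^ 2)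
      = ∫ x in (0 : ℝ)..(B + 2), (iteratedDeriv n f x) ^ 2 := by
    refine eq_of_forall_abs_sub_le_mul hCst0 fun η hη hη1 => (main η hη hη1).trans ?_
    have hA := mul_eta_bound (M := ML) hΛ0 hη hη1
    have hB' : η * (2 * MD + η) ≤ η * (1 * (2 * MD + 1)) := by
      have := mul_eta_bound (M := MD) zero_le_one hη hη1
      simpa using this
    have hsum := add_le_add (mul_le_mul_of_nonneg_left hA hBR) (mul_le_mul_of_nonneg_left hB' hB0)
    have hrew : (B + 2 - R) * (η * (Λ * (2 * ML + Λ))) + (B + 2) * (η * (1 * (2 * MD + 1)))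
        = η * Cst := by rw [hCst]; ring
    linarith
  -- shrink the intervals back to `B`
  have iL : ∀ a b, IntervalIntegrable (fun x => (ladder ι n f x) ^ 2) volume a b := fun a b =>
    (hLfC.pow 2).intervalIntegrable a b
  have iD : ∀ a b, IntervalIntegrable (fun x => (iteratedDeriv n f x) ^ 2) volume a b := fun a b =>
    (hDfC.pow 2).intervalIntegrable a b
  have hz1 : (∫ x in B..(B + 2), (ladder ι n f x) ^ 2) = 0 :=
    intervalIntegral_eq_zero_of_Ioo (by linarith) fun x hx => by
      rw [ladder_eq_zero_of_Ioi hfB n hx.1]; ring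
  have hz2 : (∫ x in B..(B + 2), (iteratedDeriv n f x) ^ 2) = 0 :=
    intervalIntegral_eq_zero_of_Ioo (by linarith) fun x hx => by
      rw [iteratedDeriv_eq_zero_of_Ioi hfB n hx.1]; ring
  rw [← intervalIntegral.integral_add_adjacent_intervals (iL R B) (iL B (B + 2)), hz1, add_zero,
    ← intervalIntegral.integral_add_adjacent_intervals (iD 0 B) (iD B (B + 2)), hz2, add_zero] at heq
  exact heq

/-- **Exact ladder isometry, position data, `f ∈ Cⁿ⁺¹`.** [cite: KenigEtAl2015, §2] -/
theorem integral_energy_ladder_eq_of_contDiff (hι : ContDiff ℝ (⊤ : ℕ∞) ι)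
    (hιeq : ∀ x : ℝ, 1 / 2 ≤ x → ι x = x⁻¹) {n : ℕ} {f : ℝ → ℝ}
    (hf : ContDiff ℝ ((n + 1 : ℕ) : ℕ∞) f) {p : ℝ[X]} (hp : ∀ i, Even i → p.coeff i = 0)
    (hpdeg : p.natDegree < 2 * n) {R R₁ B : ℝ} (hR : 1 / 2 < R) (hRR₁ : R < R₁) (hR₁B : R₁ ≤ B)
    (hfp : ∀ x, x < R₁ → f x = p.eval x) (hfB : ∀ x, B ≤ x → f x = 0) :
    ∫ x in R..B, ((deriv (ladder ι n f) x) ^ 2 + n * (n + 1) * ι x ^ 2 * (ladder ι n f x) ^ 2)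
      = ∫ x in (0 : ℝ)..B, (iteratedDeriv (n + 1) f x) ^ 2 := by
  have hn : 1 ≤ n := by
    rcases Nat.eq_zero_or_pos n with h0 | h0
    · subst h0; simp at hpdeg
    · exact h0
  have hfn : ContDiff ℝ n f := hf.of_le (by exact_mod_cast Nat.le_succ n)
  -- decomposition `f = pχ + r`
  obtain ⟨χ, hχC, hχ1, hχ0⟩ := exists_cutoff_Iic_Ici (by linarith : R₁ < B + 1)
  set P : ℝ → ℝ := fun x => p.eval x * χ x with hPdef
  have hPC : ContDiff ℝ (⊤ : ℕ∞) P := (contDiff_polynomial_eval p _).mul hχC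
  set r : ℝ → ℝ := fun x => f x - P x with hrdef
  have hrC : ContDiff ℝ ((n + 1 : ℕ) : ℕ∞) r := hf.sub (hPC.of_le (by exact_mod_cast le_top))
  have hr_lo : ∀ y, y < R₁ → r y = 0 := fun y hy => by
    simp only [hrdef, hPdef, hfp y hy, hχ1 y hy.le]; ring
  have hr_hi : ∀ y, B + 1 < y → r y = 0 := fun y hy => by
    simp only [hrdef, hPdef, hfB y (by linarith), hχ0 y hy.le]; ring
  -- the constants
  obtain ⟨Λ, hΛ0, hΛ⟩ := exists_abs_ladder_le hι hιeq n
  obtain ⟨Λ', hΛ'0, hΛ'⟩ := exists_abs_ladder_le hι hιeq (n + 1)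
  set κ : ℝ := Λ' + (n + 1) * 2 * Λ with hκ
  have hκ0 : 0 ≤ κ := by rw [hκ]; positivity
  set c : ℝ := (n : ℝ) * (n + 1) with hc
  have hc0 : 0 ≤ c := by rw [hc]; positivity
  have hB2 : R ≤ B + 2 := by linarith
  have hL1 : ∀ {u : ℝ → ℝ}, ContDiff ℝ ((n + 1 : ℕ) : ℕ∞) u → ContDiff ℝ 1 (ladder ι n u) :=
    fun hu => contDiff_ladder hι (m := 1) (by rw [add_comm]; exact hu)
  have hAfC : Continuous (deriv (ladder ι n f)) := (hL1 hf).continuous_deriv le_rfl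
  have hLfC : Continuous (ladder ι n f) := (hL1 hf).continuous
  have hWfC : Continuous fun x => ι x * ladder ι n f x := hι.continuous.mul hLfC
  have hDfC : Continuous (iteratedDeriv (n + 1) f) := hf.continuous_iteratedDeriv (n + 1) le_rfl
  obtain ⟨MA, hMA⟩ := isCompact_Icc.exists_bound_of_continuousOn (f := deriv (ladder ι n f))
    (s := Icc R (B + 2)) hAfC.continuousOn
  obtain ⟨MW, hMW⟩ := isCompact_Icc.exists_bound_of_continuousOn (f := fun x => ι x * ladder ι n f x)
    (s := Icc R (B + 2)) hWfC.continuousOn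
  obtain ⟨MD, hMD⟩ := isCompact_Icc.exists_bound_of_continuousOn (f := iteratedDeriv (n + 1) f)
    (s := Icc 0 (B + 2)) hDfC.continuousOn
  have hMA0 : 0 ≤ MA := (norm_nonneg _).trans (hMA R ⟨le_rfl, hB2⟩)
  have hMW0 : 0 ≤ MW := (norm_nonneg _).trans (hMW R ⟨le_rfl, hB2⟩)
  have hMD0 : 0 ≤ MD := (norm_nonneg _).trans (hMD 0 ⟨le_rfl, by linarith⟩)
  -- `ι ≤ 2` on `[R, ∞)`
  have hιx : ∀ x, R ≤ x → |ι x| ≤ 2 := by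
    intro x hx
    rw [hιeq x (by linarith), abs_of_pos (inv_pos.2 (by linarith))]
    rw [inv_le_comm₀ (by linarith) (by norm_num)]
    linarith
  -- splitting of the position integrand
  have hsplit : ∀ {u : ℝ → ℝ}, ContDiff ℝ ((n + 1 : ℕ) : ℕ∞) u → ∀ a b : ℝ,
      (∫ x in a..b, ((deriv (ladder ι n u) x) ^ 2 + n * (n + 1) * ι x ^ 2 * (ladder ι n u x) ^ 2))
        = (∫ x in a..b, (deriv (ladder ι n u) x) ^ 2)
          + c * ∫ x in a..b, (ι x * ladder ι n u x) ^ 2 := by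
    intro u hu a b
    have c1 : Continuous (deriv (ladder ι n u)) := (hL1 hu).continuous_deriv le_rfl
    have c2 : Continuous fun x => ι x * ladder ι n u x := hι.continuous.mul (hL1 hu).continuous
    have i1 : IntervalIntegrable (fun x => (deriv (ladder ι n u) x) ^ 2) volume a b :=
      (c1.pow 2).intervalIntegrable _ _
    have i2 : IntervalIntegrable (fun x => c * (ι x * ladder ι n u x) ^ 2) volume a b :=
      ((c2.pow 2).const_mul c).intervalIntegrable _ _
    rw [← intervalIntegral.integral_const_mul, ← intervalIntegral.integral_add i1 i2]
    refine intervalIntegral.integral_congr fun x _ => ?_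
    simp only [hc]; ring
  -- the identity up to an arbitrarily small error
  have main : ∀ η : ℝ, 0 < η → η ≤ 1 →
      |(∫ x in R..(B + 2), ((deriv (ladder ι n f) x) ^ 2 + n * (n + 1) * ι x ^ 2 * (ladder ι n f x) ^ 2))
        - ∫ x in (0 : ℝ)..(B + 2), (iteratedDeriv (n + 1) f x) ^ 2|
        ≤ (B + 2 - R) * (κ * η * (2 * MA + κ * η)) + c * ((B + 2 - R) * (2 * Λ * η * (2 * MW + 2 * Λ * η)))
          + (B + 2) * (η * (2 * MD + η)) := by
    intro η hη hη1
    obtain ⟨ε, hε, hε1, φ, hφC, hφlo, hφhi, hφapp⟩ := exists_smooth_approx_Ck hrC hr_lo hr_hi hη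
      (lt_min (by linarith : (0 : ℝ) < (R₁ - R) / 3) one_half_pos)
    have hεR : ε < (R₁ - R) / 3 := lt_of_lt_of_le hε1 (min_le_left _ _)
    have hεh : ε < 1 / 2 := lt_of_lt_of_le hε1 (min_le_right _ _)
    set g : ℝ → ℝ := fun x => P x + φ x with hgdef
    have hgC : ContDiff ℝ ((2 * n + 2 : ℕ) : ℕ∞) g := (hPC.add hφC).of_le (by exact_mod_cast le_top)
    have hgp : ∀ x ∈ Icc 0 (R₁ - 2 * ε), g x = p.eval x := by
      intro x hx
      simp only [hgdef, hPdef, hχ1 x (by linarith [hx.2]), hφlo x hx.2]; ring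
    have hgB : ∀ x, B + 2 ≤ x → g x = 0 := by
      intro x hx
      simp only [hgdef, hPdef, hχ0 x (by linarith), hφhi x (by linarith)]; ring
    have hiso := integral_energy_ladder_eq hι hιeq hgC hp hpdeg hR (by linarith : R < R₁ - 2 * ε)
      (by linarith : R₁ - 2 * ε ≤ B + 2) hgp hgB
    -- differences
    have hgn1 : ContDiff ℝ ((n + 1 : ℕ) : ℕ∞) g := hgC.of_le (by exact_mod_cast (by omega : n + 1 ≤ 2 * n + 2))
    have hgn : ContDiff ℝ n g := hgn1.of_le (by exact_mod_cast Nat.le_succ n)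
    have hφn1 : ContDiff ℝ ((n + 1 : ℕ) : ℕ∞) φ := hφC.of_le (by exact_mod_cast le_top)
    have hdn1 : ContDiff ℝ ((n + 1 : ℕ) : ℕ∞) (fun y => φ y - r y) := hφn1.sub hrC
    have hdn : ContDiff ℝ n (fun y => φ y - r y) := hdn1.of_le (by exact_mod_cast Nat.le_succ n)
    have hdiff : ∀ x, g x - f x = φ x - r x := fun x => by simp only [hgdef, hrdef]; ring
    have hgf : (fun x => g x - f x) = fun x => φ x - r x := funext hdiff
    have hDd : ∀ j, j ≤ n + 1 → ∀ x, |iteratedDeriv j (fun y => φ y - r y) x| ≤ η := by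
      intro j hj x
      rw [iteratedDeriv_fun_sub (hφn1.contDiffAt.of_le (by exact_mod_cast hj))
        (hrC.contDiffAt.of_le (by exact_mod_cast hj))]
      exact hφapp j hj x
    have hDtop : ∀ x, |iteratedDeriv (n + 1) g x - iteratedDeriv (n + 1) f x| ≤ η := by
      intro x
      have e : iteratedDeriv (n + 1) g x - iteratedDeriv (n + 1) f x
          = iteratedDeriv (n + 1) (fun y => g y - f y) x := by
        rw [iteratedDeriv_fun_sub hgn1.contDiffAt hf.contDiffAt]
      rw [e, hgf]; exact hDd (n + 1) le_rfl x
    -- ladders of the difference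
    have hLsub : ladder ι n g = fun x => ladder ι n f x + ladder ι n (fun y => φ y - r y) x := by
      have e := ladder_sub hι hgn hfn
      rw [hgf] at e
      funext x
      have hx : ladder ι n (fun y => φ y - r y) x = ladder ι n g x - ladder ι n f x := congrFun e x
      linarith
    have hL'sub : ∀ x, ladder ι (n + 1) g x - ladder ι (n + 1) f x
        = ladder ι (n + 1) (fun y => φ y - r y) x := by
      intro x
      have := congrFun (ladder_sub hι hgn1 hf) x
      rw [← this, hgf]
    have hLd : ∀ x, R ≤ x → |ladder ι n g x - ladder ι n f x| ≤ Λ * η := by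
      intro x hx
      have e : ladder ι n g x - ladder ι n f x = ladder ι n (fun y => φ y - r y) x := by
        rw [hLsub]; ring
      rw [e]
      exact hΛ _ hdn η (fun j hj => hDd j (by omega)) x (by linarith)
    have hAd : ∀ x ∈ Icc R (B + 2), |deriv (ladder ι n g) x - deriv (ladder ι n f) x| ≤ κ * η := by
      intro x hx
      have hx' : 1 / 2 < x := by linarith [hx.1]
      -- `(L_n u)' = L_{n+1} u + (n+1) ι L_n u`
      have hsucc : ∀ (u : ℝ → ℝ), deriv (ladder ι n u) x
          = ladder ι (n + 1) u x + (n + 1) * ι x * ladder ι n u x := by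
        intro u; rw [ladder_succ, ladderStep_apply]; push_cast; ring
      rw [hsucc g, hsucc f]
      have e : ladder ι (n + 1) g x + (n + 1) * ι x * ladder ι n g x
          - (ladder ι (n + 1) f x + (n + 1) * ι x * ladder ι n f x)
          = ladder ι (n + 1) (fun y => φ y - r y) x
            + (n + 1) * ι x * (ladder ι n g x - ladder ι n f x) := by
        rw [← hL'sub x]; ring
      rw [e]
      have h1 : |ladder ι (n + 1) (fun y => φ y - r y) x| ≤ Λ' * η := hΛ' _ hdn1 η hDd x hx'
      have hn0 : (0 : ℝ) ≤ n + 1 := by positivity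
      have h2 : |(n + 1) * ι x * (ladder ι n g x - ladder ι n f x)| ≤ (n + 1) * 2 * (Λ * η) := by
        rw [abs_mul, abs_mul, abs_of_nonneg hn0]
        exact mul_le_mul (mul_le_mul_of_nonneg_left (hιx x hx.1) hn0) (hLd x hx.1)
          (abs_nonneg _) (by positivity)
      have h3 : Λ' * η + (n + 1) * 2 * (Λ * η) = κ * η := by rw [hκ]; ring
      exact ((abs_add_le _ _).trans (add_le_add h1 h2)).trans h3.le
    have hWd : ∀ x ∈ Icc R (B + 2), |ι x * ladder ι n g x - ι x * ladder ι n f x| ≤ 2 * Λ * η := by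
      intro x hx
      rw [← mul_sub, abs_mul]
      calc |ι x| * |ladder ι n g x - ladder ι n f x| ≤ 2 * (Λ * η) :=
            mul_le_mul (hιx x hx.1) (hLd x hx.1) (abs_nonneg _) (by norm_num)
        _ = 2 * Λ * η := by ring
    -- the three square-integral differences
    have eA := abs_integral_sq_sub_sq_le ((hL1 hgn1).continuous_deriv le_rfl) hAfC hB2
      (by positivity) hAd (fun x hx => by have := hMA x hx; rwa [Real.norm_eq_abs] at this)
    have eW := abs_integral_sq_sub_sq_le (hι.continuous.mul (hL1 hgn1).continuous) hWfC hB2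
      (by positivity) hWd (fun x hx => by have := hMW x hx; rwa [Real.norm_eq_abs] at this)
    have eD := abs_integral_sq_sub_sq_le (hgn1.continuous_iteratedDeriv (n + 1) le_rfl) hDfC
      (by linarith : (0 : ℝ) ≤ B + 2) hη.le (fun x _ => hDtop x)
      (fun x hx => by have := hMD x hx; rwa [Real.norm_eq_abs] at this)
    rw [hsplit hgn1, hsplit hf] at *
    -- assemble with the triangle inequality
    have hcW : |c * (∫ x in R..(B + 2), (ι x * ladder ι n g x) ^ 2)
        - c * ∫ x in R..(B + 2), (ι x * ladder ι n f x) ^ 2|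
        ≤ c * ((B + 2 - R) * (2 * Λ * η * (2 * MW + 2 * Λ * η))) := by
      rw [← mul_sub, abs_mul, abs_of_nonneg hc0]
      exact mul_le_mul_of_nonneg_left eW hc0
    have key : |((∫ x in R..(B + 2), (deriv (ladder ι n f) x) ^ 2)
        + c * ∫ x in R..(B + 2), (ι x * ladder ι n f x) ^ 2)
        - ∫ x in (0 : ℝ)..(B + 2), (iteratedDeriv (n + 1) f x) ^ 2|
        ≤ |(∫ x in R..(B + 2), (deriv (ladder ι n g) x) ^ 2) - ∫ x in R..(B + 2), (deriv (ladder ι n f) x) ^ 2|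
          + |c * (∫ x in R..(B + 2), (ι x * ladder ι n g x) ^ 2)
              - c * ∫ x in R..(B + 2), (ι x * ladder ι n f x) ^ 2|
          + |(∫ x in (0 : ℝ)..(B + 2), (iteratedDeriv (n + 1) g x) ^ 2)
              - ∫ x in (0 : ℝ)..(B + 2), (iteratedDeriv (n + 1) f x) ^ 2| := by
      rw [← hiso]
      set a1 := ∫ x in R..(B + 2), (deriv (ladder ι n g) x) ^ 2
      set a2 := ∫ x in R..(B + 2), (deriv (ladder ι n f) x) ^ 2
      set b1 := c * ∫ x in R..(B + 2), (ι x * ladder ι n g x) ^ 2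
      set b2 := c * ∫ x in R..(B + 2), (ι x * ladder ι n f x) ^ 2
      set D := ∫ x in (0 : ℝ)..(B + 2), (iteratedDeriv (n + 1) f x) ^ 2
      have e : a2 + b2 - D = (a1 + b1 - D) - (a1 - a2) - (b1 - b2) := by ring
      have t1 := abs_sub (a1 + b1 - D - (a1 - a2)) (b1 - b2)
      have t2 := abs_sub (a1 + b1 - D) (a1 - a2)
      rw [e]
      linarith
    have : (B + 2 - 0) * (η * (2 * MD + η)) = (B + 2) * (η * (2 * MD + η)) := by ring
    linarith [key, eA, hcW, eD]
  -- let `η → 0`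
  have hBR : 0 ≤ B + 2 - R := by linarith
  have hB0 : 0 ≤ B + 2 := by linarith
  set Cst : ℝ := (B + 2 - R) * (κ * (2 * MA + κ)) + c * ((B + 2 - R) * (2 * Λ * (2 * MW + 2 * Λ)))
    + (B + 2) * (1 * (2 * MD + 1)) with hCst
  have hCst0 : 0 ≤ Cst := by
    rw [hCst]
    refine add_nonneg (add_nonneg (mul_nonneg hBR (by positivity))
      (mul_nonneg hc0 (mul_nonneg hBR (by positivity)))) (mul_nonneg hB0 (by positivity))
  have heq : (∫ x in R..(B + 2), ((deriv (ladder ι n f) x) ^ 2 + n * (n + 1) * ι x ^ 2 * (ladder ι n f x) ^ 2))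
      = ∫ x in (0 : ℝ)..(B + 2), (iteratedDeriv (n + 1) f x) ^ 2 := by
    refine eq_of_forall_abs_sub_le_mul hCst0 fun η hη hη1 => (main η hη hη1).trans ?_
    have hA := mul_eta_bound (M := MA) hκ0 hη hη1
    have hW := mul_eta_bound (M := MW) (by positivity : (0 : ℝ) ≤ 2 * Λ) hη hη1
    have hD : η * (2 * MD + η) ≤ η * (1 * (2 * MD + 1)) := by
      have := mul_eta_bound (M := MD) zero_le_one hη hη1
      simpa using this
    have hsum := add_le_add (add_le_add (mul_le_mul_of_nonneg_left hA hBR)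
      (mul_le_mul_of_nonneg_left (mul_le_mul_of_nonneg_left hW hBR) hc0))
      (mul_le_mul_of_nonneg_left hD hB0)
    have hrew : (B + 2 - R) * (η * (κ * (2 * MA + κ))) + c * ((B + 2 - R) * (η * (2 * Λ * (2 * MW + 2 * Λ))))
        + (B + 2) * (η * (1 * (2 * MD + 1))) = η * Cst := by rw [hCst]; ring
    linarith
  -- shrink the intervals back to `B`
  have hPc : Continuous fun x => (deriv (ladder ι n f) x) ^ 2 + n * (n + 1) * ι x ^ 2 * (ladder ι n f x) ^ 2 :=
    (hAfC.pow 2).add (((continuous_const.mul continuous_const).mul (hι.continuous.pow 2)).mul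
      (hLfC.pow 2))
  have iP : ∀ a b, IntervalIntegrable
      (fun x => (deriv (ladder ι n f) x) ^ 2 + n * (n + 1) * ι x ^ 2 * (ladder ι n f x) ^ 2) volume a b :=
    fun a b => hPc.intervalIntegrable a b
  have iD : ∀ a b, IntervalIntegrable (fun x => (iteratedDeriv (n + 1) f x) ^ 2) volume a b := fun a b =>
    (hDfC.pow 2).intervalIntegrable a b
  have hz1 : (∫ x in B..(B + 2), ((deriv (ladder ι n f) x) ^ 2 + n * (n + 1) * ι x ^ 2 * (ladder ι n f x) ^ 2)) = 0 :=
    intervalIntegral_eq_zero_of_Ioo (by linarith) fun x hx => by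
      rw [deriv_ladder_eq_zero_of_Ioi hfB n hx.1, ladder_eq_zero_of_Ioi hfB n hx.1]; ring
  have hz2 : (∫ x in B..(B + 2), (iteratedDeriv (n + 1) f x) ^ 2) = 0 :=
    intervalIntegral_eq_zero_of_Ioo (by linarith) fun x hx => by
      rw [iteratedDeriv_eq_zero_of_Ioi hfB (n + 1) hx.1]; ring
  rw [← intervalIntegral.integral_add_adjacent_intervals (iP R B) (iP B (B + 2)), hz1, add_zero,
    ← intervalIntegral.integral_add_adjacent_intervals (iD 0 B) (iD B (B + 2)), hz2, add_zero] at heq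
  exact heq

end Literature.Analysis.ODE
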